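import Mathlib.AlgebraicGeometry.Sites.BigZariski
import Mathlib.AlgebraicGeometry.Cover.Open
import Mathlib.CategoryTheory.Sites.DenseSubsite.OneHypercoverDense
import Mathlib.CategoryTheory.Sites.DenseSubsite.InducedTopology
import Mathlib.CategoryTheory.Sites.Coverage
import HarnessLib

/-!
# Zariski sheaves on schemes are Zariski sheaves on affine schemes (the big Zariski comparison lemma)

Topic: `Literature/AlgebraicGeometry/Motives` (functor-of-points infrastructure next to the
Grassmannian files it serves). Görtz–Wedhorn, *Algebraic Geometry I*, Exercise 8.1: a
contravariant functor on affine schemes is a *Zariski sheaf on (Aff)* if it satisfies the sheaf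
axiom for the finite standard open coverings `Spec A = ⋃ D(fᵢ)`; restriction along
`(Aff) ⊂ (Sch)` is an equivalence between Zariski sheaves on `(Sch)` and Zariski sheaves on
`(Aff)`. We prove this for `Type u`-valued sheaves on `Scheme.{u}`, with `(Aff)` realised as
`Scheme.Spec : CommRingCat.{u}ᵒᵖ ⥤ Scheme.{u}`, on top of Mathlib's dense-subsite machinery
(Johnstone's comparison lemma in J. Riou's `1`-hypercover-dense form, which builds the extension
of a sheaf on `(Aff)` to a scheme `X` as a `u`-SMALL limit over an affine `1`-hypercover of `X` —
so no universe bump occurs, although `(Spec ↓ X)` is a large category):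

* `Spec_isCoverDense` — every scheme is Zariski-covered by affine schemes
  (`Scheme.Spec.IsCoverDense Scheme.zariskiTopology`).
* `Spec_isOneHypercoverDense` — `Scheme.Spec` is `1`-hypercover dense for the induced topology
  `J₀ := Scheme.Spec.inducedTopology Scheme.zariskiTopology` on `CommRingCatᵒᵖ`.
* `isEquivalence_sheafPushforwardContinuous_Spec` — **restriction
  `Sheaf Scheme.zariskiTopology (Type u) ⥤ Sheaf J₀ (Type u)` is an equivalence of categories**
  (use `Functor.asEquivalence` for the inverse «extend to all schemes», its unit and counit).
* `mem_inducedTopology_Spec_iff` — **`J₀` is the topology of finite standard open coverings**: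
  a sieve on `op A` is `J₀`-covering iff it contains the localisations `A → A[1/fᵢ]` for a
  finite family `fᵢ` generating the unit ideal.
* `isSheaf_inducedTopology_Spec_iff`, `presheafIsSheaf_inducedTopology_Spec_iff` — a presheaf on
  `CommRingCatᵒᵖ` is a `J₀`-sheaf iff it satisfies `Presieve.IsSheafFor` for every finite
  standard open covering (Mathlib `Presieve.isSheaf_coverage` for the standard-open coverage).
* `isSheaf_unopUnop_comp_iff` — the same for a covariant `G : CommRingCat ⥤ Type u`, with the sheaf
  axiom spelled out (`Presieve.Arrows.Compatible` families have unique gluings).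
* `arrowsCompatible_iff_of_weakPushout` — compatibility of a family may be tested on any chosen
  models `Bᵢⱼ` of `A[1/fᵢfⱼ]` (weak pushouts of `A[1/fᵢ] ← A → A[1/fⱼ]`).

## Sources

* U. Görtz, T. Wedhorn, *Algebraic Geometry I* (2nd ed. 2020), Ch. 8, (8.3) and Exercise 8.1.
* A. Grothendieck, J. Dieudonné, *EGA I* (1971), Ch. 0, §4.5.
* The Stacks Project, Tag 01JJ (context: representability is Zariski-local).
* P. T. Johnstone, *Sketches of an Elephant*, C2.2.3 (the comparison lemma), as implemented in
  Mathlib by J. Riou (`CategoryTheory/Sites/DenseSubsite/OneHypercoverDense.lean`).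

Not here: the analogous statements for the étale/fppf/fpqc topologies; separatedness.
-/

namespace Literature.AlgebraicGeometry.Motives

universe u

open CategoryTheory CategoryTheory.Limits Opposite _root_.AlgebraicGeometry TopologicalSpace

/-! ## `Scheme.Spec` is a dense subsite for the Zariski topology -/

/-- **Every scheme is Zariski-covered by affine schemes**: `Scheme.Spec : CommRingCatᵒᵖ ⥤ Scheme`
is cover-dense for the big Zariski topology (the sieve generated by the morphisms from affine
schemes contains the affine cover `X.affineCover`). [cite: GortzWedhorn2020, Proposition and Definition 3.2] -/
theorem Spec_isCoverDense : Scheme.Spec.IsCoverDense Scheme.zariskiTopology.{u} := by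
  constructor
  intro X
  refine Scheme.zariskiTopology.superset_covering ?_ X.affineCover.mem_grothendieckTopology
  rintro Y f ⟨Z, a, b, ⟨i⟩, rfl⟩
  exact ⟨{ obj := op _, lift := a, map := X.affineCover.f i, fac := rfl }⟩

/-- **`Scheme.Spec` is `1`-hypercover dense** for the Zariski topology and its induced topology
`J₀` on `CommRingCatᵒᵖ` (with `u`-small index types): every scheme has an affine open cover, and
`Scheme` has pullbacks (Mathlib `Functor.IsOneHypercoverDense.of_hasPullbacks`). This is the
size condition under which the comparison lemma needs no universe bump.
[cite: GortzWedhorn2020, Ch. 8 Exercise 8.1] -/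
theorem Spec_isOneHypercoverDense :
    haveI := Spec_isCoverDense.{u}
    Scheme.Spec.IsOneHypercoverDense.{u}
      (Scheme.Spec.inducedTopology Scheme.zariskiTopology.{u}) Scheme.zariskiTopology.{u} := by
  haveI := Spec_isCoverDense.{u}
  refine Functor.IsOneHypercoverDense.of_hasPullbacks fun S => ?_
  exact ⟨S.affineCover.I₀, fun i => op _, fun i => S.affineCover.f i,
    S.affineCover.mem_grothendieckTopology⟩

/-- **The big Zariski comparison lemma** (Görtz–Wedhorn Exercise 8.1): restriction along
`Scheme.Spec`, `Sheaf Scheme.zariskiTopology (Type u) ⥤ Sheaf J₀ (Type u)` with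
`J₀ = Scheme.Spec.inducedTopology Scheme.zariskiTopology` the topology of standard open coverings
(`mem_inducedTopology_Spec_iff`), is an EQUIVALENCE of categories: a `Type u`-valued Zariski
sheaf on `Scheme.{u}` is the same as a `Type u`-valued Zariski sheaf on affine schemes
`CommRingCat.{u}ᵒᵖ`. The inverse («extend a functor of points given on rings to all schemes»),
unit and counit are `(…).asEquivalence`; in particular for a `J₀`-sheaf `G₀` the extension `G`
satisfies `G.val.obj (op (Spec A)) ≅ G₀.val.obj (op (op A))` naturally in `A` (counit).
[cite: GortzWedhorn2020, Ch. 8 Exercise 8.1] -/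
theorem isEquivalence_sheafPushforwardContinuous_Spec :
    (Scheme.Spec.sheafPushforwardContinuous (Type u)
      (Scheme.Spec.inducedTopology Scheme.zariskiTopology.{u}) Scheme.zariskiTopology.{u}).IsEquivalence := by
  haveI := Spec_isCoverDense.{u}
  haveI := Spec_isOneHypercoverDense.{u}
  exact Functor.isEquivalence_of_isOneHypercoverDense _ _ _ (Type u)

/-! ## The induced topology on `CommRingCatᵒᵖ` is the topology of standard open coverings -/

/-- **`J₀`-covering sieves are exactly those containing a finite standard open covering**: for a
ring `A`, a sieve `S` on `op A` is covering for `Scheme.Spec.inducedTopology zariskiTopology` iff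
there are finitely many `f₁, …, fₙ ∈ A` generating the unit ideal such that every localisation
`A → A[1/fᵢ]` (as an arrow `op A[1/fᵢ] ⟶ op A`) belongs to `S`. (⇐: the `Spec A[1/fᵢ]` form an
open cover of `Spec A`; ⇒: a Zariski cover of `Spec A` is refined by basic opens `D(a_𝔭) ∋ 𝔭`,
whose inclusions lift through the cover, and `Spec` is fully faithful; finitely many `a_𝔭`
already generate `A`.) [cite: GortzWedhorn2020, Ch. 8 Exercise 8.1] -/
theorem mem_inducedTopology_Spec_iff {A : CommRingCat.{u}} (S : Sieve (op A)) :
    S ∈ Scheme.Spec.inducedTopology Scheme.zariskiTopology.{u} (op A) ↔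
      ∃ (ι : Type u) (_ : Finite ι) (f : ι → A), Ideal.span (Set.range f) = ⊤ ∧
        ∀ i, S (CommRingCat.ofHom (algebraMap A (Localization.Away (f i)))).op := by
  haveI := Spec_isCoverDense.{u}
  rw [Functor.mem_inducedTopology_iff_of_isCoverDense]
  constructor
  · intro hS
    obtain ⟨𝒰, h𝒰⟩ := Scheme.exists_cover_of_mem_grothendieckTopology hS
    -- every point has a basic open neighbourhood whose localisation map lies in `S`
    have key : ∀ p : PrimeSpectrum A, ∃ a : A, a ∉ p.asIdeal ∧
        S (CommRingCat.ofHom (algebraMap A (Localization.Away a))).op := by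
      intro p
      have hp : (p : ↥(Spec A)) ∈ Set.range (𝒰.f (𝒰.idx p)) := 𝒰.covers p
      have hopen : IsOpen (Set.range (𝒰.f (𝒰.idx p))) :=
        (𝒰.f (𝒰.idx p)).isOpenEmbedding.isOpen_range
      obtain ⟨_, ⟨a, rfl⟩, hpa, hsub⟩ :=
        PrimeSpectrum.isTopologicalBasis_basic_opens.exists_subset_of_mem_open hp hopen
      refine ⟨a, hpa, ?_⟩
      set loc : op (CommRingCat.of (Localization.Away a)) ⟶ op A :=
        (CommRingCat.ofHom (algebraMap A (Localization.Away a))).op with hloc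
      have hrange : Set.range (Scheme.Spec.map loc) ⊆ Set.range (𝒰.f (𝒰.idx p)) := by
        refine subset_trans (subset_of_eq ?_) hsub
        exact PrimeSpectrum.localization_away_comap_range (Localization.Away a) a
      have hmem : (S.functorPushforward Scheme.Spec) (Scheme.Spec.map loc) := by
        have h1 : (S.functorPushforward Scheme.Spec) (𝒰.f (𝒰.idx p)) :=
          h𝒰 _ (𝒰.f (𝒰.idx p)) (Presieve.ofArrows.mk (𝒰.idx p))
        have h2 := (S.functorPushforward Scheme.Spec).downward_closed h1
          (IsOpenImmersion.lift (𝒰.f (𝒰.idx p)) (Scheme.Spec.map loc) hrange)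
        rwa [IsOpenImmersion.lift_fac] at h2
      obtain ⟨Z, g, h, hg, hfac⟩ := hmem
      obtain ⟨γ, rfl⟩ := Scheme.Spec.map_surjective h
      have hcomp : loc = γ ≫ g :=
        Scheme.Spec.map_injective (by rw [Functor.map_comp]; exact hfac)
      rw [hcomp]
      exact S.downward_closed hg γ
    choose a ha hS' using key
    -- the `a_𝔭` generate the unit ideal; keep finitely many of them
    have hspan : Ideal.span (Set.range a) = ⊤ := by
      rw [← PrimeSpectrum.iSup_basicOpen_eq_top_iff]
      exact top_le_iff.mp fun p _ => Opens.mem_iSup.mpr ⟨p, ha p⟩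
    obtain ⟨T, hTsub, hT1⟩ := Submodule.mem_span_finite_of_mem_span
      ((Ideal.eq_top_iff_one _).mp hspan)
    refine ⟨↥T, inferInstance, fun t => (t : A), ?_, fun t => ?_⟩
    · rw [Ideal.eq_top_iff_one]
      have hr : Set.range (fun t : ↥T => (t : A)) = (T : Set A) := Subtype.range_coe_subtype
      rw [hr]
      exact hT1
    · obtain ⟨p, hp⟩ := hTsub t.2
      change S (CommRingCat.ofHom (algebraMap A (Localization.Away (t : A)))).op
      rw [← hp]
      exact hS' p
  · rintro ⟨ι, _, f, hf, hS⟩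
    refine Scheme.zariskiTopology.superset_covering ?_
      (Scheme.affineOpenCoverOfSpanRangeEqTop f hf).openCover.mem_grothendieckTopology
    rintro Y g ⟨W, b, c, ⟨i⟩, rfl⟩
    exact ⟨op (.of (Localization.Away (f i))), _, b, hS i, rfl⟩

/-! ## The sheaf condition for `J₀`: gluing on finite standard open coverings -/

/-- **A presheaf on affine schemes is a `J₀`-sheaf iff it glues on finite standard open coverings**
(Görtz–Wedhorn Exercise 8.1, definition of a Zariski sheaf on `(Aff)`): for
`P : (CommRingCatᵒᵖ)ᵒᵖ ⥤ Type u`, `P` is a sheaf for `Scheme.Spec.inducedTopology zariskiTopology`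
iff for every ring `A` and every finite family `f` generating the unit ideal, `P` satisfies the
sheaf axiom for the presieve of the localisations `op A[1/fᵢ] ⟶ op A`. Proof: these presieves
form a coverage (pull back a standard covering of `A` along `A → B` to the standard covering of
`B` by the images, the squares `A[1/fᵢ] → B[1/φfᵢ]` being `IsLocalization.Away.map`), which
generates `J₀` by `mem_inducedTopology_Spec_iff`; conclude by Mathlib `Presieve.isSheaf_coverage`.
[cite: GortzWedhorn2020, Ch. 8 Exercise 8.1] -/
theorem isSheaf_inducedTopology_Spec_iff (P : (CommRingCat.{u}ᵒᵖ)ᵒᵖ ⥤ Type u) :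
    Presieve.IsSheaf (Scheme.Spec.inducedTopology Scheme.zariskiTopology.{u}) P ↔
      ∀ (A : CommRingCat.{u}) (ι : Type u) [Finite ι] (f : ι → A),
        Ideal.span (Set.range f) = ⊤ →
        Presieve.IsSheafFor P (Presieve.ofArrows
          (fun i => op (CommRingCat.of (Localization.Away (f i))))
          (fun i => (CommRingCat.ofHom (algebraMap A (Localization.Away (f i)))).op)) := by
  -- the standard-open coverage on `CommRingCatᵒᵖ`
  let K : Coverage (CommRingCat.{u}ᵒᵖ) :=
    { coverings := fun X => {R | ∃ (ι : Type u) (_ : Finite ι) (f : ι → X.unop),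
        Ideal.span (Set.range f) = ⊤ ∧
        R = Presieve.ofArrows (fun i => op (CommRingCat.of (Localization.Away (f i))))
          (fun i => (CommRingCat.ofHom (algebraMap X.unop (Localization.Away (f i)))).op)}
      pullback := by
        rintro X Y g R ⟨ι, hι, f, hf, rfl⟩
        -- `g = φ.op` for a ring map `φ : X.unop → Y.unop`; cover `Y` by the `φ (f i)`
        let φ : (X.unop : Type u) →+* Y.unop := g.unop.hom
        refine ⟨Presieve.ofArrows (fun i => op (CommRingCat.of (Localization.Away (φ (f i)))))
          (fun i => (CommRingCat.ofHom (algebraMap Y.unop (Localization.Away (φ (f i))))).op),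
          ⟨ι, hι, fun i => φ (f i), ?_, rfl⟩, ?_⟩
        · have h := Ideal.map_span φ (Set.range f)
          rw [hf, Ideal.map_top, ← Set.range_comp] at h
          exact h.symm
        · rintro Z _ ⟨i⟩
          refine ⟨op (CommRingCat.of (Localization.Away (f i))),
            (CommRingCat.ofHom (IsLocalization.Away.map (Localization.Away (f i))
              (Localization.Away (φ (f i))) φ (f i))).op,
            (CommRingCat.ofHom (algebraMap X.unop (Localization.Away (f i)))).op, ⟨i⟩, ?_⟩
          apply Quiver.Hom.unop_inj
          ext x
          simp [φ, IsLocalization.Away.map] }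
  -- `K` generates the induced topology
  have hK : K.toGrothendieck = Scheme.Spec.inducedTopology Scheme.zariskiTopology.{u} := by
    apply le_antisymm
    · rw [Coverage.toGrothendieck_eq_sInf]
      refine sInf_le fun X R ⟨ι, hι, f, hf, hR⟩ => ?_
      rw [GrothendieckTopology.mem_toCoverage_iff, mem_inducedTopology_Spec_iff]
      exact ⟨ι, hι, f, hf, fun i => Sieve.le_generate R _ _ (hR ▸ Presieve.ofArrows.mk i)⟩
    · intro X S hS
      obtain ⟨ι, hι, f, hf, hS'⟩ := (mem_inducedTopology_Spec_iff S).mp hS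
      refine K.mem_toGrothendieck_sieves_of_superset (R := Presieve.ofArrows
        (fun i => op (CommRingCat.of (Localization.Away (f i))))
        (fun i => (CommRingCat.ofHom (algebraMap X.unop (Localization.Away (f i)))).op)) ?_
        ⟨ι, hι, f, hf, rfl⟩
      rintro Y g ⟨i⟩
      exact hS' i
  rw [← hK, Presieve.isSheaf_coverage]
  constructor
  · intro h A ι _ f hf
    exact h _ ⟨ι, inferInstance, f, hf, rfl⟩
  · rintro h X R ⟨ι, hι, f, hf, rfl⟩
    exact h X.unop ι f hf

/-- The same criterion for Mathlib's `Presheaf.IsSheaf` (the predicate carried by the objects of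
`Sheaf J₀ (Type u)`). [cite: GortzWedhorn2020, Ch. 8 Exercise 8.1] -/
theorem presheafIsSheaf_inducedTopology_Spec_iff (P : (CommRingCat.{u}ᵒᵖ)ᵒᵖ ⥤ Type u) :
    Presheaf.IsSheaf (Scheme.Spec.inducedTopology Scheme.zariskiTopology.{u}) P ↔
      ∀ (A : CommRingCat.{u}) (ι : Type u) [Finite ι] (f : ι → A),
        Ideal.span (Set.range f) = ⊤ →
        Presieve.IsSheafFor P (Presieve.ofArrows
          (fun i => op (CommRingCat.of (Localization.Away (f i))))
          (fun i => (CommRingCat.ofHom (algebraMap A (Localization.Away (f i)))).op)) := by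
  rw [isSheaf_iff_isSheaf_of_type, isSheaf_inducedTopology_Spec_iff]

/-! ## Covariant functors on rings -/

section Covariant

variable (G : CommRingCat.{u} ⥤ Type u)

/-- **Zariski sheaves on `(Aff)` as covariant functors on rings** (Görtz–Wedhorn Exercise 8.1 /
(8.3) (Sh)): a functor `G : CommRingCat ⥤ Type u`, viewed as the presheaf `unopUnop _ ⋙ G` on
`CommRingCatᵒᵖ`, is a `J₀`-sheaf iff for every ring `A` and finite family `f` generating the unit
ideal, every family `xᵢ ∈ G(A[1/fᵢ])` which is COMPATIBLE — `G(gᵢ)(xᵢ) = G(gⱼ)(xⱼ)` whenever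
`gᵢ : A[1/fᵢ] → C`, `gⱼ : A[1/fⱼ] → C` agree on `A` — is the image of a unique `x ∈ G(A)`.
[cite: GortzWedhorn2020, Ch. 8 Exercise 8.1] -/
theorem isSheaf_unopUnop_comp_iff :
    Presheaf.IsSheaf (Scheme.Spec.inducedTopology Scheme.zariskiTopology.{u})
        (unopUnop CommRingCat.{u} ⋙ G) ↔
      ∀ (A : CommRingCat.{u}) (ι : Type u) [Finite ι] (f : ι → A),
        Ideal.span (Set.range f) = ⊤ →
        ∀ x : ∀ i, G.obj (CommRingCat.of (Localization.Away (f i))),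
          (∀ (i j : ι) (C : CommRingCat.{u})
            (gi : CommRingCat.of (Localization.Away (f i)) ⟶ C)
            (gj : CommRingCat.of (Localization.Away (f j)) ⟶ C),
            CommRingCat.ofHom (algebraMap A (Localization.Away (f i))) ≫ gi =
              CommRingCat.ofHom (algebraMap A (Localization.Away (f j))) ≫ gj →
            G.map gi (x i) = G.map gj (x j)) →
          ∃! s : G.obj A, ∀ i, G.map (CommRingCat.ofHom (algebraMap A (Localization.Away (f i)))) s = x i := by
  rw [presheafIsSheaf_inducedTopology_Spec_iff]
  refine forall₅_congr fun A ι _ f hf => ?_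
  rw [Presieve.isSheafFor_arrows_iff]
  refine forall_congr' fun x => ?_
  refine imp_congr ?_ Iff.rfl
  constructor
  · intro hx i j C gi gj h
    exact hx i j (op C) gi.op gj.op (Quiver.Hom.unop_inj h)
  · intro hx i j Z gi gj h
    exact hx i j Z.unop gi.unop gj.unop (Quiver.Hom.op_inj h)

/-- **Compatibility may be tested on chosen models of the double localisations**: if for all
`i, j` the ring `B i j` with maps `ψl : A[1/fᵢ] → Bᵢⱼ`, `ψr : A[1/fⱼ] → Bᵢⱼ` agreeing on `A` is a
weak pushout of `A[1/fᵢ] ← A → A[1/fⱼ]` (every pair `gᵢ, gⱼ` into `C` agreeing on `A` factors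
through some `Bᵢⱼ → C`; e.g. `Bᵢⱼ = A[1/fᵢfⱼ]` by the universal property of localisation), then a
family `xᵢ ∈ G(A[1/fᵢ])` is compatible as soon as `G(ψl)(xᵢ) = G(ψr)(xⱼ)` for all `i, j`.
[cite: GortzWedhorn2020, Ch. 8 (8.3)] -/
theorem arrowsCompatible_of_weakPushout {A : CommRingCat.{u}} {ι : Type u} (f : ι → A)
    (B : ι → ι → CommRingCat.{u})
    (ψl : ∀ i j, CommRingCat.of (Localization.Away (f i)) ⟶ B i j)
    (ψr : ∀ i j, CommRingCat.of (Localization.Away (f j)) ⟶ B i j)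
    (huniv : ∀ (i j : ι) (C : CommRingCat.{u})
      (gi : CommRingCat.of (Localization.Away (f i)) ⟶ C)
      (gj : CommRingCat.of (Localization.Away (f j)) ⟶ C),
      CommRingCat.ofHom (algebraMap A (Localization.Away (f i))) ≫ gi =
        CommRingCat.ofHom (algebraMap A (Localization.Away (f j))) ≫ gj →
      ∃ θ : B i j ⟶ C, ψl i j ≫ θ = gi ∧ ψr i j ≫ θ = gj)
    (x : ∀ i, G.obj (CommRingCat.of (Localization.Away (f i))))
    (hx : ∀ i j, G.map (ψl i j) (x i) = G.map (ψr i j) (x j))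
    (i j : ι) (C : CommRingCat.{u})
    (gi : CommRingCat.of (Localization.Away (f i)) ⟶ C)
    (gj : CommRingCat.of (Localization.Away (f j)) ⟶ C)
    (h : CommRingCat.ofHom (algebraMap A (Localization.Away (f i))) ≫ gi =
      CommRingCat.ofHom (algebraMap A (Localization.Away (f j))) ≫ gj) :
    G.map gi (x i) = G.map gj (x j) := by
  obtain ⟨θ, hl, hr⟩ := huniv i j C gi gj h
  rw [← hl, ← hr, G.map_comp, G.map_comp]
  simp only [types_comp_apply, hx]

/-- **The canonical double localisation is a weak pushout**: two ring maps `gᵢ : A[1/a] → C`,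
`gⱼ : A[1/b] → C` agreeing on `A` both factor through `A[1/ab]` via the canonical maps
`awayToAwayRight a b : A[1/a] → A[1/ab]` and `awayToAwayLeft b a : A[1/b] → A[1/ab]` (`a`, `b`
become units in `C`, hence so does `ab`; use `IsLocalization.Away.lift`). This discharges the
hypothesis `huniv` of `arrowsCompatible_of_weakPushout` for `Bᵢⱼ := A[1/fᵢfⱼ]`.
[cite: GortzWedhorn2020, Ch. 8 (8.3)] -/
theorem exists_desc_of_comp_eq {A : CommRingCat.{u}} (a b : A) (C : CommRingCat.{u})
    (gi : CommRingCat.of (Localization.Away a) ⟶ C)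
    (gj : CommRingCat.of (Localization.Away b) ⟶ C)
    (h : CommRingCat.ofHom (algebraMap A (Localization.Away a)) ≫ gi =
      CommRingCat.ofHom (algebraMap A (Localization.Away b)) ≫ gj) :
    ∃ θ : CommRingCat.of (Localization.Away (a * b)) ⟶ C,
      CommRingCat.ofHom (IsLocalization.Away.awayToAwayRight (S := Localization.Away a)
        (P := Localization.Away (a * b)) a b) ≫ θ = gi ∧
      CommRingCat.ofHom (IsLocalization.Away.awayToAwayLeft (S := Localization.Away b)
        (P := Localization.Away (a * b)) b a) ≫ θ = gj := by
  -- the common restriction `g : A → C`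
  set g : (A : Type u) →+* C := gi.hom.comp (algebraMap A (Localization.Away a)) with hg_def
  have hg : g = gj.hom.comp (algebraMap A (Localization.Away b)) := by
    have := congrArg CommRingCat.Hom.hom h
    simpa only [CommRingCat.hom_comp, CommRingCat.hom_ofHom] using this
  have ha : IsUnit (g a) := by
    simpa only [hg_def, RingHom.comp_apply] using
      (IsLocalization.Away.algebraMap_isUnit (S := Localization.Away a) a).map gi.hom
  have hb : IsUnit (g b) := by
    rw [hg]
    simpa only [RingHom.comp_apply] using
      (IsLocalization.Away.algebraMap_isUnit (S := Localization.Away b) b).map gj.hom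
  have hab : IsUnit (g (a * b)) := by
    rw [map_mul]
    exact ha.mul hb
  refine ⟨CommRingCat.ofHom (IsLocalization.Away.lift (S := Localization.Away (a * b))
    (a * b) hab), ?_, ?_⟩
  · ext : 1
    rw [CommRingCat.hom_comp, CommRingCat.hom_ofHom, CommRingCat.hom_ofHom]
    refine IsLocalization.ringHom_ext (Submonoid.powers a) ?_
    ext y
    simp only [RingHom.comp_apply, IsLocalization.Away.awayToAwayRight_eq,
      IsLocalization.Away.lift_eq]
    rfl
  · ext : 1
    rw [CommRingCat.hom_comp, CommRingCat.hom_ofHom, CommRingCat.hom_ofHom]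
    refine IsLocalization.ringHom_ext (Submonoid.powers b) ?_
    ext y
    simp only [RingHom.comp_apply, IsLocalization.Away.awayToAwayLeft_eq,
      IsLocalization.Away.lift_eq]
    exact (RingHom.congr_fun hg y).symm ▸ rfl

end Covariant

end Literature.AlgebraicGeometry.Motives
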